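import Summits.CriticalPhenomena.SAWScalingLimit.Theorems.LeftRightFKG.Negative.CornerCertBoxes
import Literature.Probability.RandomPlanarGeometry.SelfAvoidingWalkCert
import HarnessLib

/-!
# Negative knowledge on crux `LeftRightFKG`, part 9c: the box corner minors AT `x_c` (computational grade)

The window certificates `sq5`, `sq6`, `sq7` of part 9 (`CornerCertBoxes.lean`) hold on
`[200/539, 5/13] = [1/2.695, 1/2.6]`; that this window contains the critical fugacity `x_c = 1/μ(ℤ²)` is the tree's
COMPUTATIONAL-GRADE enclosure `2.6 ≤ μ(ℤ²) ≤ 2.695` (`SAW.le_connectiveConstant_26`: Kesten–Jensen irreducible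
bridges with certified strip transfer matrices; `SAW.connectiveConstant_le_2695`: the Pönitz–Tittmann memory-16
automaton; both `native_decide`, axiom `Lean.ofReduceBool`).  This file takes that one step and records the three
corner minors at `x_c` itself; it is kept separate so that parts 8–9 stay axiom-clean.  (The `3 × 3` and `4 × 4`
minors are positive at `x_c` unconditionally, part 9.)
-/

namespace Summit.CriticalPhenomena.SAWScalingLimit.Theorems.LeftRightFKG.Negative.CornerCert

open Literature.Analysis.ValidatedNumerics Literature.Probability.RandomPlanarGeometry
open PolyMP (evalR)
open PolyCert (realOf)

/-- **The computational window of the critical fugacity**: `x_c ∈ [200/539, 5/13]`, i.e. `1/2.695 ≤ x_c ≤ 1/2.6`,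
from the kernel-certified (computational-grade) `2.6 ≤ μ(ℤ²) ≤ 2.695`. [cite: LawlerSchrammWerner2004SAW, §3.1] -/
theorem criticalFugacity_mem_compWindow :
    (((200 / 539 : ℚ)) : ℝ) ≤ SAW.criticalFugacity ∧ SAW.criticalFugacity ≤ (((5 / 13 : ℚ)) : ℝ) := by
  have h1 : (2.6 : ℝ) ≤ SAW.connectiveConstant := SAW.le_connectiveConstant_26
  have h2 : SAW.connectiveConstant ≤ 2.695 := SAW.connectiveConstant_le_2695
  have hpos : 0 < SAW.connectiveConstant := by linarith
  constructor
  · rw [SAW.criticalFugacity, show (((200 / 539 : ℚ) : ℝ)) = (2.695 : ℝ)⁻¹ by push_cast; norm_num]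
    exact (inv_le_inv₀ (by norm_num) hpos).2 h2
  · rw [SAW.criticalFugacity, show (((5 / 13 : ℚ) : ℝ)) = (2.6 : ℝ)⁻¹ by push_cast; norm_num]
    exact (inv_le_inv₀ hpos (by norm_num)).2 h1

/-- **The `5 × 5` corner minor is positive AT `x_c`** (computational grade: the window contains `x_c`). [folklore] -/
theorem sq5_minor_pos_criticalFugacity :
    evalR (realOf sq5_m12) SAW.criticalFugacity * evalR (realOf sq5_m21) SAW.criticalFugacity <
      evalR (realOf sq5_m11) SAW.criticalFugacity * evalR (realOf sq5_m22) SAW.criticalFugacity :=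
  sq5_minor_pos criticalFugacity_mem_compWindow.1 criticalFugacity_mem_compWindow.2

/-- **The `6 × 6` corner minor is positive AT `x_c`** (computational grade). [folklore] -/
theorem sq6_minor_pos_criticalFugacity :
    evalR (realOf sq6_m12) SAW.criticalFugacity * evalR (realOf sq6_m21) SAW.criticalFugacity <
      evalR (realOf sq6_m11) SAW.criticalFugacity * evalR (realOf sq6_m22) SAW.criticalFugacity :=
  sq6_minor_pos criticalFugacity_mem_compWindow.1 criticalFugacity_mem_compWindow.2

/-- **The `7 × 7` corner minor is positive AT `x_c`** (computational grade). [folklore] -/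
theorem sq7_minor_pos_criticalFugacity :
    evalR (realOf sq7_m12) SAW.criticalFugacity * evalR (realOf sq7_m21) SAW.criticalFugacity <
      evalR (realOf sq7_m11) SAW.criticalFugacity * evalR (realOf sq7_m22) SAW.criticalFugacity :=
  sq7_minor_pos criticalFugacity_mem_compWindow.1 criticalFugacity_mem_compWindow.2

end Summit.CriticalPhenomena.SAWScalingLimit.Theorems.LeftRightFKG.Negative.CornerCert
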